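import Literature.MathematicalPhysics.QuantumFieldTheory.Balaban1983to89.B9Thm313WholeDvHolderAtPins
import Literature.MathematicalPhysics.QuantumFieldTheory.Balaban1983to89.B9GradViaDivLettersTransported
import Literature.MathematicalPhysics.QuantumFieldTheory.Balaban1983to89.B9SmoothHolderClassGraded
import Literature.MathematicalPhysics.QuantumFieldTheory.Balaban1983to89.B9MultiscaleSmoothPartitionYNear

/-!
# `Balaban1983to89.B9Thm313WholeDvHolderAtPinsGraded` — THE FOUR D_U-ORBIT HÖLDER MEMBERS OF ROWS 20–21 AT THE GRADED TRANSPORTED PIN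
# `bH13 := weightNorm (bHZG (taxiS U) p w) (Lʲη)⁻¹` (OPTION (2), graded per LOCATED-U5): `h44DsDv`, `dgDHd`, `dgDH`, `pYDH β` — each a PROJECTION of the graded
# source to one exponent `s ∈ (0,1)` (`hasMaj_from_bHZG`) composed with the transported J-letter `hasMaj_JcoKH_taxi` (NO small-gauge binder) and g17∕g18's
# class-generic engines, the (3.44)∕(3.45) members displayed at the exponent-`s` transported bond class `bHZKT (taxiB U) s p`

T. Bałaban, *Propagators for lattice gauge theories in a background field*, Commun. Math. Phys. **99** (1985) 389–434
[`Balaban1985BackgroundPropagators`, "B9"]; [4] = T. Bałaban, *Propagators and renormalization transformations for lattice gauge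
theories. II*, Commun. Math. Phys. **96** (1984) 223–250 [`Balaban1984PropagatorsII`].

statement-level skeleton of published theorems with citation tags; proofs where landed; nothing here is a claim about the
Yang–Mills mass gap

THE PRINTED LOCI.  [B9] Thm 3.3 (3.44)–(3.45) p. 398 + the remark after (3.47) (*"λ replaced by a function J defined at bonds"*); Thm 3.13 p. 426 with (3.152)–(3.153);
(3.3) p. 390; (3.35) p. 396; (3.40) p. 397; Thm 3.1 p. 397 (*"B₀(β) → ∞ if β → 1"*); [4] (2.51)–(2.56) pp. 232–233, Lemma 2.1 (2.60)–(2.61) p. 234.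

WHY THIS FILE (cell `pub-ymgap`, node N06, seat dag-n06-l g21; the knit's WORD-TZ INBOX l.40854 «pins STAY FREE until OPTION (2)» + LOCATED-U5 HOME `BH13-EXPONENT-MEMO.md`).
g20's `B9Thm313WholeDvHolderAtPinsSmooth` pinned the four members at the FLAT class `bHZ 1 p` with the gauge-variant `hΘ`; U5 showed no single exponent can
serve producers and consumers.  HERE: source `bH13 := weightNorm (bHZG i b (taxiS U) h1p w) (Lʲη)⁻¹` (graded over `s ∈ (0,1)`, transported by def-Y's taxicab site
table), input class of the displayed (3.44)∕(3.45) members = `bHZKT i b (taxiB U) s p` at the ONE exponent `s` the member is read at (`s₀` for the sup members, `s(β) > β`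
for the probe member — the knit's choice, constants `(w s)⁻¹`-scaled), configuration binders = `hUG` (links ∈ SU(N)) + the GAUGE-INVARIANT plaquette binder `hF`:
* §0 `thetaL`, `CJG` (the projected letter constant `(w s)⁻¹·cR39·CJT·e^{δ·rZ(rNear+1)}`), ★★ `hasMaj_JcoKH_graded` (graded source → exponent-`s` bond class, radius
  discharged by n06-w6's LAYER B), ★ `hasMaj_JcoKH_graded_len` (from the `(Lʲη)⁻¹`-weighted source);
* §1 ★★ `h44DsDv_pins_graded`, ★★ `dgDHd_pins_graded`, ★★ `dgDH_pins_graded`, ★★ `pYDH_pins_graded` — VERBATIM twins of g20's four `_pins_smooth` with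
  (`bHZ ↦ bHZG`, `bHZK ↦ bHZKT … s`, `hΘ ↦ hF`, `CJS ↦ CJG`).
HONEST SCOPE.  By-name compositions of landed engines; the (3.44)∕(3.45) members, `hF`, `RowSum`, `Facts347` are HYPOTHESES (inhabitable); nothing of [B9]∕[4]
asserted; no certificate edit (the pin is the knit's); COUNT-NEUTRAL; N06 NOT discharged; nothing continuum, nothing about the mass gap.  Cell `pub-ymgap`
(HUMAN RULING D-0062), Track A node N06 [B9], seat `pub-ymgap-dag-n06-l` (g21), 2026-08-28.
-/

noncomputable section

namespace Literature.MathematicalPhysics.QuantumFieldTheory.Balaban1983to89.B9Thm313WholeDvHolderAtPinsGraded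

open scoped Matrix.Norms.L2Operator
open Node00 B6GlobalChartV1 B6KLevelCensusIndexV1
open B6Geom246MultiLevelTorus (geomT)
open B6Ineq2142KLevelV1 (β)
open B11SectG (HasMaj RowSum BlockNorm)
open B9Thm34Ext (toB6)
open B9SectDSup (weightNorm)
open B9Thm312Whole (cNorm GeoOK Ops)
open B9Thm312WholeClasses (cNormR)
open B9RWSums343to347Whole (Facts347)
open B9Thm39ReadingCoords (cR39 cR39_nonneg)
open B9CoReadingCoords (XBK coordOpK cdBₗ cdsBₗ blkBK)
open B9CoReadingCoordsS (XSK blkSK sIK)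
open B7Prop2SpecialUnitary (specialUnitaryUnits specialUnitaryUnits_le_U1)
open Node00.OpsYSectDCoords (DvcoKH)
open B9GeoNormsKLevelV1 (geo9K)
open B9GradViaDivLettersAtPins (JcoKH rJ sliceProjK DvcoKH_eq_sum DcoK_eq_sum)
open B9GradViaDivLettersAtPinsHolderPairs (hasMaj_weight_source_inv_len)
open B9Thm313WholeDvHolderFromDds (h44DsDv_of_h44Ds dgDHd_of_h44m dgDH_of_h44m pYDH_of_h45Y)
open B9Thm313WholeDvHolderAtPins (hasMaj_sliceProjK_cNorm)
open B9RWSums343Holder (HolderProbes)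
open B9MultiscaleSmoothPartitionYNear (rNear dist_sIK_le_of_nearY)
open B9MultiscaleSmoothPartitionYLip (CLip CLip_nonneg)
open B9SmoothHolderClassT (bHZT bHZKT bHZKT_κ)
open B9SmoothHolderClassGraded (bHZG hasMaj_from_bHZG)
open B9GradViaDivLettersSmoothTerms (rZ)
open B9GradViaDivLettersTransported (CJT CJT_nonneg taxiS taxiB hasMaj_JcoKH_taxi)
open B9TaxiTransportLadder (plaqV)
open Node00.OpsYNablaBridge (chartY)

variable {d ℓ : ℕ} {hd : 1 ≤ d + 1} {hL : Odd (ℓ + 1) ∧ 1 < ℓ + 1} {b₀ b₁ : ℝ}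
variable (i : KIdx d ℓ hd hL b₀ b₁) [Fintype (geo9K i).Site] {κ : Type} [Fintype κ]

/-! ## §0 The constants and the projected transported J-letter -/

/-- the ladder constant of the taxicab letter from the plaquette constant: `ϑ_L := 2·(d+1)·L²·ϑ_F`. [cite: Balaban1985BackgroundPropagators, (3.35) p.396 + (3.40) p.397, dictionary] -/
def thetaL (d ℓ : ℕ) (ϑF : ℝ) : ℝ := 2 * ((d : ℝ) + 1) * (((ℓ + 1 : ℕ) : ℝ)) ^ 2 * ϑF

/-- `0 ≤ thetaL` for `ϑ_F ≥ 0`. [cite: Balaban1985BackgroundPropagators, (3.35) p.396, bookkeeping] -/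
theorem thetaL_nonneg (d ℓ : ℕ) {ϑF : ℝ} (h : 0 ≤ ϑF) : 0 ≤ thetaL d ℓ ϑF := by unfold thetaL; positivity

/-- the PROJECTED letter constant at exponent `s` (weight value `ws = w s`), radius discharged: `ws⁻¹·cR39·CJT·e^{δ·rZ(rNear + 1)}`. OURS.
[cite: Balaban1985BackgroundPropagators, (3.3) p.390 + (3.45) p.398 («B′₀(ε,β)») + p.398 (remark after (3.47)), dictionary] -/
def CJG {𝔸 : Type} [NormedRing 𝔸] [NormedAlgebra ℂ 𝔸] [FiniteDimensional ℝ 𝔸] (d ℓ : ℕ) (b : Module.Basis κ ℝ 𝔸) (p ϑL ws δ : ℝ) : ℝ :=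
  ws⁻¹ * (cR39 b * CJT b ℓ p ϑL * Real.exp (δ * rZ d ℓ (rNear d ℓ + 1)))

omit [Fintype (geo9K i).Site] in
/-- `0 ≤ CJG` for `ϑ_L ≥ 0`, `ws > 0`. [cite: Balaban1985BackgroundPropagators, (3.48) p.398, bookkeeping] -/
theorem CJG_nonneg {𝔸 : Type} [NormedRing 𝔸] [NormedAlgebra ℂ 𝔸] [FiniteDimensional ℝ 𝔸] (b : Module.Basis κ ℝ 𝔸) {p ϑL ws : ℝ} (hϑ : 0 ≤ ϑL) (hws : 0 < ws)
    (δ : ℝ) : 0 ≤ CJG d ℓ b p ϑL ws δ := by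
  have := cR39_nonneg b
  have := CJT_nonneg (b := b) (ℓ := ℓ) (p := p) hϑ
  unfold CJG; positivity

section Letter

variable {𝔸 : Type} [NormedRing 𝔸] [NormedAlgebra ℂ 𝔸] [CompleteSpace 𝔸]
variable (b : Module.Basis κ ℝ 𝔸) [FiniteDimensional ℝ 𝔸] (B : B9.Backgrounds) (cfg : B.Cfg → CfgY 𝔸 i)
variable {bI : FBondY i → IBondY i}

/-- ★★ **THE TRANSPORTED J-LETTER OUT OF THE GRADED SOURCE** — `J_μ(U₁) : bHZG (taxiS U₁) p w → bHZKT (taxiB U₁) s p` for any exponent `0 < s < 1` with `0 < w s`: the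
projection `hasMaj_from_bHZG` at `s` of `hasMaj_JcoKH_taxi` (radius discharged by LAYER B); constant `CJG … (w s) δ · e^{−δd}`; binders `hU` (contracting links) and the
plaquette binder `hF` only. [cite: Balaban1985BackgroundPropagators, (3.3) p.390 + (3.35) p.396 + (3.40) p.397 + (3.45) p.398 + p.398 (remark after (3.47)); Balaban1984PropagatorsII, (2.51)–(2.54) p.232] -/
theorem hasMaj_JcoKH_graded {R₀ : ℝ} {H₀ : Prop} {p : ℝ} (h1p : 1 ≤ p) (w : ℝ → ℝ) (hw0 : ∀ s, 0 ≤ w s) (hw1 : ∀ s, w s ≤ 1)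
    {s : ℝ} (hs0 : 0 < s) (hs1 : s < 1) (hws : 0 < w s)
    (hβ1 : ∀ f : FBondY i, (geomT i.D).dist (β i.hN i.D i.hk (bI f)) (blkV1 i.hN i.D f) ≤ 1)
    (hbI0 : ∀ f : FBondY i, bI f = bI ⟨f.src, 0⟩) {U₁ : B.Cfg}
    (hU : ∀ (ν : Fin (d + 1)) (x : Site (PV d ℓ i.m i.K hd hL) 0), ‖(cfg U₁ ν x : 𝔸)‖ ≤ 1 ∧ ‖(((cfg U₁ ν x)⁻¹ : 𝔸ˣ) : 𝔸)‖ ≤ 1)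
    {ϑF : ℝ} (hϑF : 0 ≤ ϑF)
    (hF : ∀ (y : Site (PV d ℓ i.m i.K hd hL) 0) (μ' ν' : Fin (d + 1)),
      ‖(plaqV (cfg U₁) y μ' ν' : 𝔸) - 1‖ ≤ ϑF * ((((ℓ + 1 : ℕ) : ℝ)) ^ levY i (chartY i y))⁻¹)
    {δ : ℝ} (hδ : 0 ≤ δ) (μ : Fin (d + 1)) :
    HasMaj (bHZG (κ := κ) i b (taxiS i B cfg U₁) (R := R₀) (H := H₀) h1p w hw0 hw1)
      (bHZKT (κ := κ) i b (taxiB i B cfg U₁) (R := R₀) (H := H₀) hs0.le hs1.le (hs1.le.trans h1p)) (JcoKH i b B cfg μ U₁)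
      (fun y y' => CJG d ℓ b p (thetaL d ℓ ϑF) (w s) δ * Real.exp (-(δ * (geo9K i).dist y y'))) := by
  have hϑL : 0 ≤ thetaL d ℓ ϑF := thetaL_nonneg d ℓ hϑF
  have hK : ∀ a c : IBondY i, 0 ≤ cR39 b * CJT b ℓ p (thetaL d ℓ ϑF) * Real.exp (δ * rZ d ℓ (rNear d ℓ + 1)) * Real.exp (-(δ * (geo9K i).dist a c)) :=
    fun a c => by have := cR39_nonneg b; have := CJT_nonneg (b := b) (ℓ := ℓ) (p := p) hϑL; positivity
  have hJ := hasMaj_JcoKH_taxi i b B cfg (R₀ := R₀) (H₀ := H₀) hs0.le hs1.le (hs1.le.trans h1p) hβ1 hbI0 hU hϑF hF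
    (fun _ _ h => dist_sIK_le_of_nearY i hβ1 h) hδ μ
  have hJ' : HasMaj (bHZT (κ := κ) i b (taxiS i B cfg U₁) (R := R₀) (H := H₀) hs0.le hs1.le (hs1.le.trans h1p))
      (bHZKT (κ := κ) i b (taxiB i B cfg U₁) (R := R₀) (H := H₀) hs0.le hs1.le (hs1.le.trans h1p)) (JcoKH i b B cfg μ U₁)
      (fun y y' => cR39 b * CJT b ℓ p (thetaL d ℓ ϑF) * Real.exp (δ * rZ d ℓ (rNear d ℓ + 1)) * Real.exp (-(δ * (geo9K i).dist y y'))) := by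
    unfold thetaL; exact hJ
  exact (hasMaj_from_bHZG i b h1p w hw0 hw1 (taxiS i B cfg U₁) hs0 hs1 hws hK hJ').mono fun y y' => le_of_eq (by unfold CJG; ring)

/-- ★ **THE PROJECTED LETTER FROM THE `(Lʲη)⁻¹`-WEIGHTED GRADED SOURCE** (`bH13 := weightNorm (bHZG …) (Lʲη)⁻¹`): kernel `CJG·L·(Lʲη)(a)·e^{−(δ−αδ_F)d}` ([4] (2.60)).
[cite: Balaban1985BackgroundPropagators, (3.3) p.390 + p.398 (remark after (3.47)); Balaban1984PropagatorsII, Lemma 2.1 (2.60) p.234] -/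
theorem hasMaj_JcoKH_graded_len (hG : GeoOK (geo9K i)) {R₀ : ℝ} {H₀ : Prop} {dF : ℕ} {δ' α L₀ : ℝ} (hFa : Facts347 (geo9K i) R₀ H₀ dF δ' α L₀)
    {p : ℝ} (h1p : 1 ≤ p) (w : ℝ → ℝ) (hw0 : ∀ s, 0 ≤ w s) (hw1 : ∀ s, w s ≤ 1) {s : ℝ} (hs0 : 0 < s) (hs1 : s < 1) (hws : 0 < w s)
    (hβ1 : ∀ f : FBondY i, (geomT i.D).dist (β i.hN i.D i.hk (bI f)) (blkV1 i.hN i.D f) ≤ 1)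
    (hbI0 : ∀ f : FBondY i, bI f = bI ⟨f.src, 0⟩) {U₁ : B.Cfg}
    (hU : ∀ (ν : Fin (d + 1)) (x : Site (PV d ℓ i.m i.K hd hL) 0), ‖(cfg U₁ ν x : 𝔸)‖ ≤ 1 ∧ ‖(((cfg U₁ ν x)⁻¹ : 𝔸ˣ) : 𝔸)‖ ≤ 1)
    {ϑF : ℝ} (hϑF : 0 ≤ ϑF)
    (hF : ∀ (y : Site (PV d ℓ i.m i.K hd hL) 0) (μ' ν' : Fin (d + 1)),
      ‖(plaqV (cfg U₁) y μ' ν' : 𝔸) - 1‖ ≤ ϑF * ((((ℓ + 1 : ℕ) : ℝ)) ^ levY i (chartY i y))⁻¹)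
    {δ : ℝ} (hδ : 0 ≤ δ) (μ : Fin (d + 1)) :
    HasMaj (weightNorm (bHZG (κ := κ) i b (taxiS i B cfg U₁) (R := R₀) (H := H₀) h1p w hw0 hw1) (fun y => ((geo9K i).len y)⁻¹) fun y => inv_nonneg.2 (hG.lenle y))
      (bHZKT (κ := κ) i b (taxiB i B cfg U₁) (R := R₀) (H := H₀) hs0.le hs1.le (hs1.le.trans h1p)) (JcoKH i b B cfg μ U₁)
      (fun a a' => CJG d ℓ b p (thetaL d ℓ ϑF) (w s) δ * (geo9K i).L * (geo9K i).len a * Real.exp (-((δ - α * δ') * (geo9K i).dist a a'))) :=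
  hasMaj_weight_source_inv_len hG hFa (CJG_nonneg (d := d) (ℓ := ℓ) b (thetaL_nonneg d ℓ hϑF) hws δ)
    (hasMaj_JcoKH_graded i b B cfg h1p w hw0 hw1 hs0 hs1 hws hβ1 hbI0 hU hϑF hF hδ μ)

end Letter

/-! ## §1 The four members at the graded transported pin, SU(N) links -/

section Members

variable {N : ℕ} [NeZero N] (B : B9.Backgrounds) (rd : B.Cfg → CfgY (Matrix (Fin N) (Fin N) ℂ) i) (b : Module.Basis κ ℝ (Matrix (Fin N) (Fin N) ℂ))
variable {bI : FBondY i → IBondY i}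
variable {p : ℝ} (h1p : (1 : ℝ) ≤ p) (w : ℝ → ℝ) (hw0 : ∀ s, 0 ≤ w s) (hw1 : ∀ s, w s ≤ 1) {s : ℝ} (hs0 : 0 < s) (hs1 : s < 1) (hws : 0 < w s)
include hws

/-- ★★ **`Thm33G0DivR.h44DsDv` AT THE GRADED TRANSPORTED PIN** — D\*G₀D_U : `bHZG (taxiS U) p w → 𝔠_W⁽⁰⁾` from the displayed directional (3.44) members `h44Ds μ` at the input class
`bHZKT (taxiB U) s p` and the projected transported J-letter; `B_dD ≥ (d+1)·(1 + C_Lip)·B_iD·CJG·c`, `0 ≤ δ₃ ≤ δ₀`, `δ₃ + σ ≤ δ_J`.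
[cite: Balaban1985BackgroundPropagators, Thm 3.3 (3.44) p.398 + (3.3) p.390 + (3.35) p.396 + p.398 (remarks after (3.47)); Balaban1984PropagatorsII, (2.26) p.228 + (2.52)–(2.56) pp.232–233 + Lemma 2.1 (2.61) p.234] -/
theorem h44DsDv_pins_graded {R₀ : ℝ} {H₀ : Prop}
    (hβ1 : ∀ f : FBondY i, (geomT i.D).dist (β i.hN i.D i.hk (bI f)) (blkV1 i.hN i.D f) ≤ 1)
    (hbI0 : ∀ f : FBondY i, bI f = bI ⟨f.src, 0⟩) {U : B.Cfg}
    (hUG : ∀ (ν : Fin (d + 1)) (x : Site (PV d ℓ i.m i.K hd hL) 0), rd U ν x ∈ specialUnitaryUnits (Fin N)) {ϑF : ℝ} (hϑF : 0 ≤ ϑF)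
    (hF : ∀ (y : Site (PV d ℓ i.m i.K hd hL) 0) (μ' ν' : Fin (d + 1)),
      ‖(plaqV (rd U) y μ' ν' : Matrix (Fin N) (Fin N) ℂ) - 1‖ ≤ ϑF * ((((ℓ + 1 : ℕ) : ℝ)) ^ levY i (chartY i y))⁻¹)
    (hG : GeoOK (geo9K i)) {σ c : ℝ} (hrow : RowSum (toB6 (geo9K i) R₀ H₀) σ c) {Y : Type} [Fintype Y] {W : Type} [Fintype W]
    (𝔬 : Ops (geo9K i) B (XBK κ i) Y W (XSK κ i))
    (hDv : 𝔬.Dv U = DvcoKH i b B rd U)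
    {Dds : Fin (d + 1) → Module.End ℝ (XBK κ i → ℝ)} (hDds : Dds = fun μ => coordOpK b (fun _ : Fin (d + 1) => cdsBₗ i (rd U) μ))
    {BiD δ₀ δJ BdD δ₃ : ℝ} (hBiD : 0 ≤ BiD) (hδJ : 0 ≤ δJ) (hδ₃ : 0 ≤ δ₃) (hδ₃0 : δ₃ ≤ δ₀) (hδ₃J : δ₃ + σ ≤ δJ)
    (hBdD : ((d : ℝ) + 1) * ((1 + CLip d ℓ) * BiD * CJG d ℓ b p (thetaL d ℓ ϑF) (w s) δJ * c) ≤ BdD)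
    (h44Ds : ∀ μ, HasMaj (bHZKT (κ := κ) i b (taxiB i B rd U) (R := R₀) (H := H₀) hs0.le hs1.le (hs1.le.trans h1p)) (cNormR R₀ H₀ 𝔬.blkW hG.lenle 0)
      (𝔬.Dvstar U ∘ₗ (𝔬.G0 U ∘ₗ Dds μ)) (fun a a' => BiD * Real.exp (-(δ₀ * (geo9K i).dist a a')))) :
    HasMaj (bHZG (κ := κ) i b (taxiS i B rd U) (R := R₀) (H := H₀) h1p w hw0 hw1) (cNormR R₀ H₀ 𝔬.blkW hG.lenle 0) (𝔬.Dvstar U ∘ₗ (𝔬.G0 U ∘ₗ 𝔬.Dv U))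
      (fun a a' => BdD * Real.exp (-(δ₃ * (geo9K i).dist a a'))) := by
  have hU : ∀ (ν : Fin (d + 1)) (x : Site (PV d ℓ i.m i.K hd hL) 0), ‖(rd U ν x : Matrix (Fin N) (Fin N) ℂ)‖ ≤ 1 ∧
      ‖(((rd U ν x)⁻¹ : (Matrix (Fin N) (Fin N) ℂ)ˣ) : Matrix (Fin N) (Fin N) ℂ)‖ ≤ 1 := fun ν x => specialUnitaryUnits_le_U1 (hUG ν x)
  have hDv' : 𝔬.Dv U = ∑ μ, Dds μ ∘ₗ JcoKH i b B rd μ U := by rw [hDv, hDds]; exact DvcoKH_eq_sum i b B rd U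
  have hJ : ∀ μ, HasMaj (bHZG (κ := κ) i b (taxiS i B rd U) (R := R₀) (H := H₀) h1p w hw0 hw1)
      (bHZKT (κ := κ) i b (taxiB i B rd U) (R := R₀) (H := H₀) hs0.le hs1.le (hs1.le.trans h1p)) (JcoKH i b B rd μ U)
      (fun a a' => CJG d ℓ b p (thetaL d ℓ ϑF) (w s) δJ * Real.exp (-(δJ * (geo9K i).dist a a'))) := fun μ =>
    hasMaj_JcoKH_graded i b B rd h1p w hw0 hw1 hs0 hs1 hws hβ1 hbI0 hU hϑF hF hδJ μ
  have hBdD' : (Fintype.card (Fin (d + 1)) : ℝ) * ((bHZKT (κ := κ) i b (taxiB i B rd U) (R := R₀) (H := H₀) hs0.le hs1.le (hs1.le.trans h1p)).κ * BiD *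
      CJG d ℓ b p (thetaL d ℓ ϑF) (w s) δJ * c) ≤ BdD := by
    rw [Fintype.card_fin, Nat.cast_add, Nat.cast_one, bHZKT_κ]; exact hBdD
  exact h44DsDv_of_h44Ds hG hrow hBiD (CJG_nonneg (d := d) (ℓ := ℓ) b (thetaL_nonneg d ℓ hϑF) hws δJ) hδ₃ hδ₃0 hδ₃J hBdD' hDv' h44Ds hJ

variable {dF : ℕ} {δF α L₀ : ℝ}

/-- ★★ **`Letters313DMZ.dgDHd ν` AT THE GRADED TRANSPORTED PIN `bH13 := weightNorm (bHZG (taxiS U) p w) (Lʲη)⁻¹`** — ∇_{U,ν}G₀D_U : bH13 → 𝔠⁽¹⁾ from the displayed (3.44)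
members `h44m μ` at `bHZKT (taxiB U) s p` and the length-weighted projected letter; `B₃ ≥ (d+1)·(1 + C_Lip)·B_i·L₀·(CJG·L)·c`, `0 ≤ δ₃ ≤ δ₀ − αδ_F`, `δ₃ + σ ≤ δ_J − αδ_F`.
[cite: Balaban1985BackgroundPropagators, Thm 3.3 (3.44) p.398 + (3.152)–(3.153) p.426 + (3.3) p.390 + (3.35) p.396; Balaban1984PropagatorsII, (2.26) p.228 + (2.52)–(2.56) pp.232–233 + Lemma 2.1 (2.60)–(2.61) p.234] -/
theorem dgDHd_pins_graded {R₀ : ℝ} {H₀ : Prop}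
    (hβ1 : ∀ f : FBondY i, (geomT i.D).dist (β i.hN i.D i.hk (bI f)) (blkV1 i.hN i.D f) ≤ 1)
    (hbI0 : ∀ f : FBondY i, bI f = bI ⟨f.src, 0⟩) {U : B.Cfg}
    (hUG : ∀ (ν : Fin (d + 1)) (x : Site (PV d ℓ i.m i.K hd hL) 0), rd U ν x ∈ specialUnitaryUnits (Fin N)) {ϑF : ℝ} (hϑF : 0 ≤ ϑF)
    (hF : ∀ (y : Site (PV d ℓ i.m i.K hd hL) 0) (μ' ν' : Fin (d + 1)),
      ‖(plaqV (rd U) y μ' ν' : Matrix (Fin N) (Fin N) ℂ) - 1‖ ≤ ϑF * ((((ℓ + 1 : ℕ) : ℝ)) ^ levY i (chartY i y))⁻¹)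
    (hG : GeoOK (geo9K i)) {σ c : ℝ} (hrow : RowSum (toB6 (geo9K i) R₀ H₀) σ c) (hFa : Facts347 (geo9K i) R₀ H₀ dF δF α L₀)
    {Y : Type} [Fintype Y] {W : Type} [Fintype W] (𝔬 : Ops (geo9K i) B (XBK κ i) Y W (XSK κ i))
    (hDv : 𝔬.Dv U = DvcoKH i b B rd U)
    {Dds : Fin (d + 1) → Module.End ℝ (XBK κ i → ℝ)} (hDds : Dds = fun μ => coordOpK b (fun _ : Fin (d + 1) => cdsBₗ i (rd U) μ))
    {Ddν : Module.End ℝ (XBK κ i → ℝ)} {Bi δ₀ δJ B₃ δ₃ : ℝ} (hBi : 0 ≤ Bi) (hc : 0 ≤ c) (hδJ : 0 ≤ δJ)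
    (hδ₃ : 0 ≤ δ₃) (hδ₃0 : δ₃ ≤ δ₀ - α * δF) (hδ₃J : δ₃ + σ ≤ (δJ - α * δF))
    (hB₃ : ((d : ℝ) + 1) * ((1 + CLip d ℓ) * (Bi * L₀) * (CJG d ℓ b p (thetaL d ℓ ϑF) (w s) δJ * (geo9K i).L) * c) ≤ B₃)
    (h44m : ∀ μ, HasMaj (bHZKT (κ := κ) i b (taxiB i B rd U) (R := R₀) (H := H₀) hs0.le hs1.le (hs1.le.trans h1p))
      (BlockNorm.ofBlocks (toB6 (geo9K i) R₀ H₀) 𝔬.blk)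
      (Ddν ∘ₗ (𝔬.G0 U ∘ₗ Dds μ)) (fun a a' => Bi * Real.exp (-(δ₀ * (geo9K i).dist a a')))) :
    HasMaj (weightNorm (bHZG (κ := κ) i b (taxiS i B rd U) (R := R₀) (H := H₀) h1p w hw0 hw1) (fun y => ((geo9K i).len y)⁻¹) fun y => inv_nonneg.mpr (hG.lenle y))
      (cNorm R₀ H₀ 𝔬.blk hG.lenle 1) (Ddν ∘ₗ 𝔬.G0 U ∘ₗ 𝔬.Dv U) (fun a a' => B₃ * Real.exp (-(δ₃ * (geo9K i).dist a a'))) := by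
  have hU : ∀ (ν : Fin (d + 1)) (x : Site (PV d ℓ i.m i.K hd hL) 0), ‖(rd U ν x : Matrix (Fin N) (Fin N) ℂ)‖ ≤ 1 ∧
      ‖(((rd U ν x)⁻¹ : (Matrix (Fin N) (Fin N) ℂ)ˣ) : Matrix (Fin N) (Fin N) ℂ)‖ ≤ 1 := fun ν x => specialUnitaryUnits_le_U1 (hUG ν x)
  have hDv' : 𝔬.Dv U = ∑ μ, Dds μ ∘ₗ JcoKH i b B rd μ U := by rw [hDv, hDds]; exact DvcoKH_eq_sum i b B rd U
  have hJ := fun μ => hasMaj_JcoKH_graded_len i b B rd hG hFa h1p w hw0 hw1 hs0 hs1 hws hβ1 hbI0 hU hϑF hF hδJ μ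
  have hB₃' : (Fintype.card (Fin (d + 1)) : ℝ) * ((1 + CLip d ℓ) * (Bi * L₀) * (CJG d ℓ b p (thetaL d ℓ ϑF) (w s) δJ * (geo9K i).L) * c) ≤ B₃ := by
    rw [Fintype.card_fin, Nat.cast_add, Nat.cast_one]; exact hB₃
  have hCJ : 0 ≤ CJG d ℓ b p (thetaL d ℓ ϑF) (w s) δJ * (geo9K i).L :=
    mul_nonneg (CJG_nonneg (d := d) (ℓ := ℓ) b (thetaL_nonneg d ℓ hϑF) hws δJ) (le_trans zero_le_one hFa.one_le_L)
  have hκ : (bHZKT (κ := κ) i b (taxiB i B rd U) (R := R₀) (H := H₀) hs0.le hs1.le (hs1.le.trans h1p)).κ ≤ 1 + CLip d ℓ := le_of_eq (bHZKT_κ i b _ _ _ _)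
  exact dgDHd_of_h44m hG hrow hFa hBi hCJ hc hκ hδ₃ hδ₃0 hδ₃J hB₃' hDv' h44m hJ

/-- ★★ **`Letters313DZ.dgDH` AT THE GRADED TRANSPORTED PIN** — ∇_UG₀D_U : bH13 → 𝔠_Y⁽¹⁾ with the slice-diagonal `∇_U` (`hD`: `DcoK = Σ_ν Π_ν ∘ ∇_{U,ν}`, the Π-letter
`hasMaj_sliceProjK_cNorm`), from the displayed `h44m ν μ` at `bHZKT (taxiB U) s p` and the length-weighted projected letter; `B₃` per ν as in `dgDHd_pins_graded`, then
`B₃p ≥ (d+1)·B₃·c`. [cite: Balaban1985BackgroundPropagators, Thm 3.13 p.426 + Thm 3.3 (3.44) p.398 + (3.42) p.397 + (3.152)–(3.153) p.426 + (3.3) p.390; Balaban1984PropagatorsII, (2.26) p.228 + (2.52)–(2.56) pp.232–233 + Lemma 2.1 (2.60)–(2.61) p.234] -/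
theorem dgDH_pins_graded {R₀ : ℝ} {H₀ : Prop}
    (hβ1 : ∀ f : FBondY i, (geomT i.D).dist (β i.hN i.D i.hk (bI f)) (blkV1 i.hN i.D f) ≤ 1)
    (hbI0 : ∀ f : FBondY i, bI f = bI ⟨f.src, 0⟩) {U : B.Cfg}
    (hUG : ∀ (ν : Fin (d + 1)) (x : Site (PV d ℓ i.m i.K hd hL) 0), rd U ν x ∈ specialUnitaryUnits (Fin N)) {ϑF : ℝ} (hϑF : 0 ≤ ϑF)
    (hF : ∀ (y : Site (PV d ℓ i.m i.K hd hL) 0) (μ' ν' : Fin (d + 1)),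
      ‖(plaqV (rd U) y μ' ν' : Matrix (Fin N) (Fin N) ℂ) - 1‖ ≤ ϑF * ((((ℓ + 1 : ℕ) : ℝ)) ^ levY i (chartY i y))⁻¹)
    (hG : GeoOK (geo9K i)) {σ c : ℝ} (hrow : RowSum (toB6 (geo9K i) R₀ H₀) σ c) (hFa : Facts347 (geo9K i) R₀ H₀ dF δF α L₀)
    {W : Type} [Fintype W] (𝔬 : Ops (geo9K i) B (XBK κ i) (XBK κ i) W (XSK κ i))
    (hblk : 𝔬.blk = blkBK i bI) (hblkY : 𝔬.blkY = blkBK i bI)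
    (hDv : 𝔬.Dv U = DvcoKH i b B rd U) (hD : 𝔬.D U = B9CoReadingCoords.DcoK i b B rd U)
    {Dd Dds : Fin (d + 1) → Module.End ℝ (XBK κ i → ℝ)}
    (hDd : Dd = fun ν => coordOpK b (fun _ : Fin (d + 1) => cdBₗ i (rd U) ν))
    (hDds : Dds = fun μ => coordOpK b (fun _ : Fin (d + 1) => cdsBₗ i (rd U) μ))
    {Bi δ₀ δJ B₃ δ₃ B₃p : ℝ} (hBi : 0 ≤ Bi) (hc : 0 ≤ c) (hδJ : 0 ≤ δJ)
    (hδ₃ : 0 ≤ δ₃) (hδ₃0 : δ₃ ≤ δ₀ - α * δF) (hδ₃J : δ₃ + σ ≤ (δJ - α * δF))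
    (hB₃ : ((d : ℝ) + 1) * ((1 + CLip d ℓ) * (Bi * L₀) * (CJG d ℓ b p (thetaL d ℓ ϑF) (w s) δJ * (geo9K i).L) * c) ≤ B₃)
    (hB₃p : ((d : ℝ) + 1) * (1 * B₃ * c) ≤ B₃p)
    (h44m : ∀ ν μ, HasMaj (bHZKT (κ := κ) i b (taxiB i B rd U) (R := R₀) (H := H₀) hs0.le hs1.le (hs1.le.trans h1p))
      (BlockNorm.ofBlocks (toB6 (geo9K i) R₀ H₀) 𝔬.blk)
      (Dd ν ∘ₗ (𝔬.G0 U ∘ₗ Dds μ)) (fun a a' => Bi * Real.exp (-(δ₀ * (geo9K i).dist a a')))) :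
    HasMaj (weightNorm (bHZG (κ := κ) i b (taxiS i B rd U) (R := R₀) (H := H₀) h1p w hw0 hw1) (fun y => ((geo9K i).len y)⁻¹) fun y => inv_nonneg.mpr (hG.lenle y))
      (cNorm R₀ H₀ 𝔬.blkY hG.lenle 1) (𝔬.D U ∘ₗ 𝔬.G0 U ∘ₗ 𝔬.Dv U) (fun a a' => B₃p * Real.exp (-(δ₃ * (geo9K i).dist a a'))) := by
  have hU : ∀ (ν : Fin (d + 1)) (x : Site (PV d ℓ i.m i.K hd hL) 0), ‖(rd U ν x : Matrix (Fin N) (Fin N) ℂ)‖ ≤ 1 ∧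
      ‖(((rd U ν x)⁻¹ : (Matrix (Fin N) (Fin N) ℂ)ˣ) : Matrix (Fin N) (Fin N) ℂ)‖ ≤ 1 := fun ν x => specialUnitaryUnits_le_U1 (hUG ν x)
  have hDv' : 𝔬.Dv U = ∑ μ, Dds μ ∘ₗ JcoKH i b B rd μ U := by rw [hDv, hDds]; exact DvcoKH_eq_sum i b B rd U
  have hD' : 𝔬.D U = ∑ ν, sliceProjK ν ∘ₗ Dd ν := by rw [hD, hDd]; exact DcoK_eq_sum i b B rd U
  have hJ := fun μ => hasMaj_JcoKH_graded_len i b B rd hG hFa h1p w hw0 hw1 hs0 hs1 hws hβ1 hbI0 hU hϑF hF hδJ μ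
  have hPr : ∀ ν, HasMaj (cNorm R₀ H₀ 𝔬.blk hG.lenle 1) (cNorm R₀ H₀ 𝔬.blkY hG.lenle 1) (sliceProjK (κ := κ) ν)
      (fun a a' => (1 : ℝ) * Real.exp (-((δ₃ + σ) * (geo9K i).dist a a'))) := fun ν => by
    rw [hblk, hblkY]; exact hasMaj_sliceProjK_cNorm i (blkBK i bI) hG.lenle 1 ν
  have hB₃a : (Fintype.card (Fin (d + 1)) : ℝ) * ((1 + CLip d ℓ) * (Bi * L₀) * (CJG d ℓ b p (thetaL d ℓ ϑF) (w s) δJ * (geo9K i).L) * c) ≤ B₃ := by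
    rw [Fintype.card_fin, Nat.cast_add, Nat.cast_one]; exact hB₃
  have hB₃b : (Fintype.card (Fin (d + 1)) : ℝ) * (1 * B₃ * c) ≤ B₃p := by
    rw [Fintype.card_fin, Nat.cast_add, Nat.cast_one]; exact hB₃p
  have hCJ : 0 ≤ CJG d ℓ b p (thetaL d ℓ ϑF) (w s) δJ * (geo9K i).L :=
    mul_nonneg (CJG_nonneg (d := d) (ℓ := ℓ) b (thetaL_nonneg d ℓ hϑF) hws δJ) (le_trans zero_le_one hFa.one_le_L)
  have hκ : (bHZKT (κ := κ) i b (taxiB i B rd U) (R := R₀) (H := H₀) hs0.le hs1.le (hs1.le.trans h1p)).κ ≤ 1 + CLip d ℓ := le_of_eq (bHZKT_κ i b _ _ _ _)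
  exact dgDH_of_h44m hG hrow hFa hBi hCJ zero_le_one hc hκ hδ₃ hδ₃0 hδ₃J hB₃a hδ₃ le_rfl le_rfl hB₃b hDv' hD' h44m hJ hPr

/-- ★★ **`Letters313HZ.pYDH β` AT THE GRADED TRANSPORTED PIN** — Φ^Y_β∘∇_U∘G₀∘D_U : bH13 → 𝔠_{P_Y}^{(β−1)} from the displayed directional Φ^Y-(3.45) members `h45Y μ` at the input
class `bHZKT (taxiB U) s p` — print-inhabitable for `s > β` (input exponent `β + ε`, «B′₀(ε,β)»; the knit reads the β-member at `s(β) = (1+β)∕2`) — and the projected letter;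
`BhD ≥ (d+1)·(1 + C_Lip)·B_i·L₀·(CJG·L)·c`. [cite: Balaban1985BackgroundPropagators, Thm 3.13 p.426 + (3.45) p.398 + (3.152)–(3.153) p.426 + (3.3) p.390 + (3.35) p.396; Balaban1984PropagatorsII, (2.26) p.228 + (2.52)–(2.56) pp.232–233 + Lemma 2.1 (2.60)–(2.61) p.234] -/
theorem pYDH_pins_graded {R₀ : ℝ} {H₀ : Prop}
    (hβ1 : ∀ f : FBondY i, (geomT i.D).dist (β i.hN i.D i.hk (bI f)) (blkV1 i.hN i.D f) ≤ 1)
    (hbI0 : ∀ f : FBondY i, bI f = bI ⟨f.src, 0⟩) {U : B.Cfg}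
    (hUG : ∀ (ν : Fin (d + 1)) (x : Site (PV d ℓ i.m i.K hd hL) 0), rd U ν x ∈ specialUnitaryUnits (Fin N)) {ϑF : ℝ} (hϑF : 0 ≤ ϑF)
    (hF : ∀ (y : Site (PV d ℓ i.m i.K hd hL) 0) (μ' ν' : Fin (d + 1)),
      ‖(plaqV (rd U) y μ' ν' : Matrix (Fin N) (Fin N) ℂ) - 1‖ ≤ ϑF * ((((ℓ + 1 : ℕ) : ℝ)) ^ levY i (chartY i y))⁻¹)
    (hG : GeoOK (geo9K i)) {σ c : ℝ} (hrow : RowSum (toB6 (geo9K i) R₀ H₀) σ c) (hFa : Facts347 (geo9K i) R₀ H₀ dF δF α L₀)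
    {Y : Type} [Fintype Y] {W : Type} [Fintype W] {PX PY : Type} [Fintype PX] [Fintype PY]
    (𝔬 : Ops (geo9K i) B (XBK κ i) Y W (XSK κ i)) (𝔭 : HolderProbes (geo9K i) B (XBK κ i) Y PX PY)
    (hDv : 𝔬.Dv U = DvcoKH i b B rd U)
    {Dds : Fin (d + 1) → Module.End ℝ (XBK κ i → ℝ)} (hDds : Dds = fun μ => coordOpK b (fun _ : Fin (d + 1) => cdsBₗ i (rd U) μ))
    {βH Bi δ₀ δJ BhD δ₃ : ℝ} (hBi : 0 ≤ Bi) (hc : 0 ≤ c) (hδJ : 0 ≤ δJ)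
    (hδ₃ : 0 ≤ δ₃) (hδ₃0 : δ₃ ≤ δ₀ - α * δF) (hδ₃J : δ₃ + σ ≤ (δJ - α * δF))
    (hBhD : ((d : ℝ) + 1) * ((1 + CLip d ℓ) * (Bi * L₀) * (CJG d ℓ b p (thetaL d ℓ ϑF) (w s) δJ * (geo9K i).L) * c) ≤ BhD)
    (h45Y : ∀ μ, HasMaj (bHZKT (κ := κ) i b (taxiB i B rd U) (R := R₀) (H := H₀) hs0.le hs1.le (hs1.le.trans h1p))
      (BlockNorm.ofBlocks (toB6 (geo9K i) R₀ H₀) 𝔭.blkPY)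
      (𝔭.ΦY U βH ∘ₗ (𝔬.D U ∘ₗ (𝔬.G0 U ∘ₗ Dds μ))) (fun a a' => Bi * (geo9K i).len a ^ (-βH) * Real.exp (-(δ₀ * (geo9K i).dist a a')))) :
    HasMaj (weightNorm (bHZG (κ := κ) i b (taxiS i B rd U) (R := R₀) (H := H₀) h1p w hw0 hw1) (fun y => ((geo9K i).len y)⁻¹) fun y => inv_nonneg.mpr (hG.lenle y))
      (cNormR R₀ H₀ 𝔭.blkPY hG.lenle (βH - 1)) ((𝔭.ΦY U βH ∘ₗ 𝔬.D U ∘ₗ 𝔬.G0 U) ∘ₗ 𝔬.Dv U)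
      (fun a a' => BhD * Real.exp (-(δ₃ * (geo9K i).dist a a'))) := by
  have hU : ∀ (ν : Fin (d + 1)) (x : Site (PV d ℓ i.m i.K hd hL) 0), ‖(rd U ν x : Matrix (Fin N) (Fin N) ℂ)‖ ≤ 1 ∧
      ‖(((rd U ν x)⁻¹ : (Matrix (Fin N) (Fin N) ℂ)ˣ) : Matrix (Fin N) (Fin N) ℂ)‖ ≤ 1 := fun ν x => specialUnitaryUnits_le_U1 (hUG ν x)
  have hDv' : 𝔬.Dv U = ∑ μ, Dds μ ∘ₗ JcoKH i b B rd μ U := by rw [hDv, hDds]; exact DvcoKH_eq_sum i b B rd U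
  have hJ := fun μ => hasMaj_JcoKH_graded_len i b B rd hG hFa h1p w hw0 hw1 hs0 hs1 hws hβ1 hbI0 hU hϑF hF hδJ μ
  have hBhD' : (Fintype.card (Fin (d + 1)) : ℝ) * ((1 + CLip d ℓ) * (Bi * L₀) * (CJG d ℓ b p (thetaL d ℓ ϑF) (w s) δJ * (geo9K i).L) * c) ≤ BhD := by
    rw [Fintype.card_fin, Nat.cast_add, Nat.cast_one]; exact hBhD
  have hCJ : 0 ≤ CJG d ℓ b p (thetaL d ℓ ϑF) (w s) δJ * (geo9K i).L :=
    mul_nonneg (CJG_nonneg (d := d) (ℓ := ℓ) b (thetaL_nonneg d ℓ hϑF) hws δJ) (le_trans zero_le_one hFa.one_le_L)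
  have hκ : (bHZKT (κ := κ) i b (taxiB i B rd U) (R := R₀) (H := H₀) hs0.le hs1.le (hs1.le.trans h1p)).κ ≤ 1 + CLip d ℓ := le_of_eq (bHZKT_κ i b _ _ _ _)
  exact pYDH_of_h45Y hG hrow hFa hBi hCJ hc hκ hδ₃ hδ₃0 hδ₃J hBhD' hDv' h45Y hJ

end Members

end Literature.MathematicalPhysics.QuantumFieldTheory.Balaban1983to89.B9Thm313WholeDvHolderAtPinsGraded
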